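import Literature.InformationTheory.QuantumCodes.PerfectCodesFromPasting
import HarnessLib

/-!
# Stabilizer pasting `[n₂,s₂] ▷ [n₁,s₁]` along the pair `X(n₂), Z(n₂)` (Yu–Bierbrauer–Dong–Chen–Oh 2013, §II)

Topic `Literature/InformationTheory/QuantumCodes` (venture QEC, cell `qec`; LIT-1 custody, the `d = 3` column,
constructions). S. Yu, J. Bierbrauer, Y. Dong, Q. Chen, C. H. Oh, *All the stabilizer codes of distance 3*,
IEEE Trans. Inform. Theory 59 (2013) 5179 = arXiv:0901.1968 [YuEtAl2013], §II «Notations and known results» (lit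
chunk p0004 L96–128, read on the page 2026-08-27):

«Stabilizer pasting (Gottesman [g3]): Given two non-degenerate stabilizer codes `[n₂,s₂] = ⟨S_1, S_2, …, S_{s₂}⟩` and
`[n₁,s₁] = ⟨T_1, T_2, …, T_{s₁}⟩` of distance 3, if two observables `X(n₂)` and `Z(n₂)` belong to `[n₂,s₂]`, say,
`S_1 = X(n₂)` and `S_2 = Z(n₂)`, then the stabilizer defined in Table III defines a non-degenerate stabilizer code
`[n₂ + n₁, s]` with `s = max{s₂, s₁ + 2}`, denoted as `[n₂,s₂] ▷ [n₁,s₁]`. As the first example of stabilizer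
pasting we can obtain an optimal code `[13] = [[13,7,3]]` by pasting the optimal code `[2³]` … with the perfect code
`[5]` … If there is a third pure code `[n₃,s₃]` with `X(n₃)` and `Z(n₃)` belonging to its stabilizer then the
stabilizer pasting results in a pure code `[n₁+n₂+n₃, s] = [n₃,s₃] ▷ [n₂,s₂] ▷ [n₁,s₁]` with
`s = max{s₃, s₂+2, s₁+4}`, which can be further pasted with another code and so on.» Here `[n,s]` denotes «the
stabilizer of a pure stabilizer code `[[n, n−s, 3]]`» (p0004 L10). And Lemma 1 (p0005 L12–20): «by a direct
application of the stabilizer pasting to two optimal codes we obtain a previously unknown pure optimal code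
`[[37,30,3]]` whose stabilizer reads `[37] = [2⁵] ▷ [5]`.»

This is Gottesman's pasting of §3.5 of the thesis — the tree's `Gottesman1997_pasting` / `pastedCode`
(`CodePasting.lean`) — in the special configuration `R₁ ⊇ ⟨X(n₂), Z(n₂)⟩` (a distance-two sub-stabilizer, `c₁ = 2`),
`R₂` arbitrary (`c₂ = 1`), distance `min{3, 3, 2 + 1} = 3`; the tree's `PureAdditiveCodeExists.gottesmanPaste`
(`PerfectCodesFromPasting.lean`) is the case «left factor = Gottesman's `[2^s]`, `s₁ ≥ s₂ − 2`». This file PROVES the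
step for an ARBITRARY pure left factor containing `X(n₂)`, `Z(n₂)` and for BOTH signs of `s₂ − 2 − s₁` (surplus
generators on either side are «left alone», i.e. put into `R₁` resp. `R₂`), which is what the chains of Yu et al.'s
Theorem 2 and their family `[8·m]` need.

## Contents (all PROVED; no named facts, no `sorry`)

* `exists_pure_supercode`, `PureAdditiveCodeExists.of_succ` / `.anti` — a pure `[[n,k+1,d]]` gives a pure
  `[[n,k,d]]` (enlarge `S̄` by a vector of `S̄⊥ ∖ S̄`; CRSS Thm. 6 (c) for pure codes, purity being inherited since
  `S̄′⊥ ⊆ S̄⊥`).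
* `XZPureCodeExists n k` — «the stabilizer `[n, n−k]` of a pure `[[n,k,3]]` code to which `X(n)` and `Z(n)` belong»
  (the left factors of the pasting); `XZPureCodeExists.pure`, `.of_succ`, `.anti`, `.gottesman` (`[2^m]`, `m ≥ 3`).
* `hasMinDist_two_of_xz_mem` — a stabilizer containing `X(n)`, `Z(n)` has distance `≥ 2` (`c₁ = 2`).
* `exists_label_of_le` — linear algebra: for `R̄ ≤ S̄` and `t ≤ dim S̄ − dim R̄` a label `f : Ē → 𝔽₂^t` with
  `R̄ ≤ ker f`, `dim(S̄ ∩ ker f) = dim S̄ − t`, `f(S̄) = 𝔽₂^t` (which generators get paired).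
* **`XZPureCodeExists.paste`** — the step `[n₂,s₂] ▷ [n₁,s₁]`: a pure `[[n₂ + n₁, n₂ + n₁ − max{s₂, s₁+2}, 3]]`.
* `pureAdditiveCodeExists_37_30_3` — `[37] = [2⁵] ▷ [5]`, the «previously unknown» `[[37,30,3]]` of Lemma 1
  (from the tree's `CRSS1998_theorem10` at `m = 5` and `pureAdditiveCodeExists_5_1_3`; `[13] = [2³] ▷ [5]` is the tree's
  `pureAdditiveCodeExists_13_7_3`).

Deliberately NOT here: the families `[8·m]` and Theorem 2 (separate files); 2ed-block pasting (§V). Tree search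
(2026-08-27): `pastedCode`, `Gottesman1997_pasting`, `pureAdditiveCodeExists_pasting`, `exists_label_map_eq_top`,
`two_le_sympWeight_of_sum_eq_zero`, `gottesmanCode`, `CRSS1998_theorem10`, `exists_fixedPointFree`, `allOmega`,
`allOnes`, `sympInner_allOmega/allOnes`, `IsAdditiveCode.finrank_sympDual`, `sympDual_anti` — all reused.
-/

namespace Literature.InformationTheory.QuantumCodes

open Finset Module

variable {n : ℕ}

/-! ### 1. Pure codes are monotone in `k` -/

/-- **Enlarging a pure stabilizer by one generator.** If `S̄` is a pure `[[n, k+1, d]]` code then some `S̄′ ⊇ S̄` is a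
pure `[[n, k, d]]` code: adjoin a vector `v ∈ S̄⊥ ∖ S̄` (it exists since `dim S̄⊥ = n + k + 1 > dim S̄`);
`S̄′ = S̄ + ⟨v⟩` is self-orthogonal of dimension `n − k`, and pure because `S̄′⊥ ⊆ S̄⊥`. (CRSS Thm. 6 (c) «if `k > 0`
… an `[[n, k−1, d]]` code exists», with purity carried along.) [cite: CalderbankEtAl1998, §4 Thm. 6 (c) (printed p. 13)] -/
theorem exists_pure_supercode {n k d : ℕ} {S : Submodule (ZMod 2) (SympVec n)} (hS : IsAdditiveCode S (k + 1) d)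
    (hp : IsPure S d) :
    ∃ S' : Submodule (ZMod 2) (SympVec n), S ≤ S' ∧ IsAdditiveCode S' k d ∧ IsPure S' d := by
  obtain ⟨hso, hdim, -, -⟩ := hS
  have hdual : finrank (ZMod 2) (sympDual S) = n + (k + 1) :=
    IsAdditiveCode.finrank_sympDual ⟨hso, hdim, hp.hasMinDist, fun _ v hv hv0 => hp v (hso hv) hv0⟩
  -- a vector of `S̄⊥` outside `S̄`
  have hlt : S < sympDual S := by
    refine lt_of_le_of_ne hso fun heq => ?_
    have h : finrank (ZMod 2) S = finrank (ZMod 2) (sympDual S) :=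
      congrArg (fun T : Submodule (ZMod 2) (SympVec n) => finrank (ZMod 2) T) heq
    omega
  obtain ⟨v, hvd, hvS⟩ := SetLike.exists_of_lt hlt
  have hv0 : v ≠ 0 := fun h0 => hvS (h0 ▸ S.zero_mem)
  refine ⟨S ⊔ (ZMod 2) ∙ v, le_sup_left, ?_⟩
  -- self-orthogonality of `S̄′`
  have horth : ∀ x ∈ S ⊔ (ZMod 2) ∙ v, ∀ y ∈ S ⊔ (ZMod 2) ∙ v, sympInner x y = 0 := by
    intro x hx y hy
    rw [Submodule.mem_sup] at hx hy
    obtain ⟨a, ha, b, hb, rfl⟩ := hx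
    obtain ⟨a', ha', b', hb', rfl⟩ := hy
    rw [Submodule.mem_span_singleton] at hb hb'
    obtain ⟨c, rfl⟩ := hb
    obtain ⟨c', rfl⟩ := hb'
    have e : sympInner (a + c • v) (a' + c' • v)
        = sympInner a' a + c' * sympInner v a + c * (sympInner a' v + c' * sympInner v v) := by
      rw [sympInner_add_left, sympInner_smul_left, sympInner_comm a, sympInner_add_left, sympInner_smul_left,
        sympInner_comm v (a' + c' • v), sympInner_add_left, sympInner_smul_left]
    rw [e, mem_sympDual_iff.1 (hso ha) a' ha', sympInner_comm v a, mem_sympDual_iff.1 hvd a ha,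
      mem_sympDual_iff.1 hvd a' ha', sympInner_self]
    ring
  have hso' : IsSelfOrthogonal (S ⊔ (ZMod 2) ∙ v) := fun x hx => mem_sympDual_iff.2 fun y hy => horth y hy x hx
  -- dimension `dim S̄ + 1`
  have hdim' : finrank (ZMod 2) ↥(S ⊔ (ZMod 2) ∙ v) + k = n := by
    have hinf : S ⊓ (ZMod 2) ∙ v = ⊥ := by
      rw [eq_bot_iff]
      intro x hx
      obtain ⟨hxS, hxv⟩ := Submodule.mem_inf.1 hx
      rw [Submodule.mem_span_singleton] at hxv
      obtain ⟨c, rfl⟩ := hxv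
      rw [Submodule.mem_bot]
      by_cases hc : c = 0
      · rw [hc, zero_smul]
      · exfalso
        have hc1 : c = 1 := by
          have : ∀ z : ZMod 2, z ≠ 0 → z = 1 := by decide
          exact this c hc
        rw [hc1, one_smul] at hxS
        exact hvS hxS
    have h1 := Submodule.finrank_sup_add_finrank_inf_eq S ((ZMod 2) ∙ v)
    rw [hinf, finrank_bot, add_zero, finrank_span_singleton hv0] at h1
    omega
  -- purity is inherited
  have hp' : IsPure (S ⊔ (ZMod 2) ∙ v) d := fun w hw hw0 =>
    hp w (sympDual_anti (le_sup_left : S ≤ S ⊔ (ZMod 2) ∙ v) hw) hw0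
  exact ⟨⟨hso', hdim', hp'.hasMinDist, fun _ w hw hw0 => hp' w (hso' hw) hw0⟩, hp'⟩

/-- **A pure `[[n, k+1, d]]` code yields a pure `[[n, k, d]]` code.** [cite: CalderbankEtAl1998, §4 Thm. 6 (c) (printed p. 13)] -/
theorem PureAdditiveCodeExists.of_succ {n k d : ℕ} (h : PureAdditiveCodeExists n (k + 1) d) :
    PureAdditiveCodeExists n k d := by
  obtain ⟨S, hS, hp⟩ := h
  obtain ⟨S', -, hS', hp'⟩ := exists_pure_supercode hS hp
  exact ⟨S', hS', hp'⟩

/-- A pure `[[n,k,d]]` yields a pure `[[n,k′,d]]` for every `k′ ≤ k`. [cite: CalderbankEtAl1998, §4 Thm. 6 (c) (printed p. 13)] -/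
theorem PureAdditiveCodeExists.anti {n k k' d : ℕ} (h : PureAdditiveCodeExists n k d) (hk : k' ≤ k) :
    PureAdditiveCodeExists n k' d := by
  obtain ⟨j, rfl⟩ := Nat.exists_eq_add_of_le hk
  induction j with
  | zero => simpa using h
  | succ i ih => exact ih (PureAdditiveCodeExists.of_succ (by rw [← add_assoc] at h; exact h)) (by omega)

/-! ### 2. Left factors: pure distance-3 codes containing `X(n)` and `Z(n)` -/

/-- **`[n, n−k]` with `X(n), Z(n)` in the stabilizer**: a pure `[[n,k,3]]` additive code `S̄` containing `ωω…ω = X^{⊗n}`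
(`allOmega`) and `11…1 = (X Z)^{⊗n}` (`allOnes`), hence also `Z^{⊗n}` — the left factors of Yu et al.'s stabilizer
pasting («two observables `X(n₂)` and `Z(n₂)` belong to `[n₂,s₂]`»); Gottesman's `[2^m]` and the family `[8·m]` are
such. [cite: YuEtAl2013, §II (chunk p0004 L29-36, L96-103)] -/
def XZPureCodeExists (n k : ℕ) : Prop :=
  ∃ S : Submodule (ZMod 2) (SympVec n), IsAdditiveCode S k 3 ∧ IsPure S 3 ∧ allOmega n ∈ S ∧ allOnes n ∈ S

/-- Forgetting the pair. [cite: YuEtAl2013, §II (chunk p0004 L10-12)] -/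
theorem XZPureCodeExists.pure {n k : ℕ} (h : XZPureCodeExists n k) : PureAdditiveCodeExists n k 3 := by
  obtain ⟨S, hS, hp, -, -⟩ := h
  exact ⟨S, hS, hp⟩

/-- Monotonicity in `k` for left factors (adjoining a vector of `S̄⊥ ∖ S̄` keeps `X(n), Z(n)` and purity).
[cite: CalderbankEtAl1998, §4 Thm. 6 (c) (printed p. 13)] -/
theorem XZPureCodeExists.of_succ {n k : ℕ} (h : XZPureCodeExists n (k + 1)) : XZPureCodeExists n k := by
  obtain ⟨S, hS, hp, hX, hY⟩ := h
  obtain ⟨S', hle, hS', hp'⟩ := exists_pure_supercode hS hp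
  exact ⟨S', hS', hp', hle hX, hle hY⟩

/-- Monotonicity in `k` for left factors, iterated. [cite: CalderbankEtAl1998, §4 Thm. 6 (c) (printed p. 13)] -/
theorem XZPureCodeExists.anti {n k k' : ℕ} (h : XZPureCodeExists n k) (hk : k' ≤ k) : XZPureCodeExists n k' := by
  obtain ⟨j, rfl⟩ := Nat.exists_eq_add_of_le hk
  induction j with
  | zero => simpa using h
  | succ i ih => exact ih (XZPureCodeExists.of_succ (by rw [← add_assoc] at h; exact h)) (by omega)

/-- **Gottesman's `[2^m]` is a left factor**: «By construction, these codes are non-degenerate and two observables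
`X(2^m)` and `Z(2^m)` are generators of the stabilizer» — the tree's `gottesmanCode G` (CRSS Thm. 10, any
fixed-point-free `G`) contains `allOmega` and `allOnes` among its generators. [cite: YuEtAl2013, §II (chunk p0004 L29-36)] -/
theorem XZPureCodeExists.gottesman {m : ℕ} (hm : 3 ≤ m) : XZPureCodeExists (2 ^ m) (2 ^ m - m - 2) := by
  obtain ⟨G, hG, hfix⟩ := exists_fixedPointFree (m := m) (by omega)
  obtain ⟨h₁, hp₁⟩ := CRSS1998_theorem10 hm G hG hfix
  exact ⟨gottesmanCode G, h₁, hp₁, Submodule.subset_span ⟨Sum.inl 0, rfl⟩, Submodule.subset_span ⟨Sum.inl 1, rfl⟩⟩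

/-- **`c₁ = 2`**: a stabilizer `R̄` containing `X(n)` and `(XZ)(n)` has minimum distance `≥ 2` — a Pauli word
commuting with `X^{⊗n}` and `Z^{⊗n}` has `Σ bᵢ = Σ aᵢ = 0`, so it is not of weight one («the first two generators
`X(n₂) ⊗ I(n₁)` and `Z(n₂) ⊗ I(n₁)`» detect single errors on the block). [cite: YuEtAl2013, §V (chunk p0008 L27-30); Gottesman1997, §8.4 (chunk p0071 L14-16: R₁ a distance two code)] -/
theorem hasMinDist_two_of_xz_mem {R : Submodule (ZMod 2) (SympVec n)} (hX : allOmega n ∈ R) (hY : allOnes n ∈ R) :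
    HasMinDist R 2 := by
  intro w hw hwR
  have hb : ∑ i, w.2 i = 0 := by rw [← sympInner_allOmega]; exact mem_sympDual_iff.1 hw _ hX
  have ha : ∑ i, w.1 i = 0 := by
    have := mem_sympDual_iff.1 hw _ hY
    rw [sympInner_allOnes, hb, zero_add] at this
    exact this
  exact two_le_sympWeight_of_sum_eq_zero w (fun h0 => hwR (h0 ▸ R.zero_mem)) ha hb

/-! ### 3. Labels with a prescribed sub-kernel -/

/-- **Pairing labels.** For subspaces `R̄ ≤ S̄ ≤ Ē` and `t ≤ dim S̄ − dim R̄` there is a linear `f : Ē → 𝔽₂^t` with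
`R̄ ⊆ ker f`, `dim(S̄ ∩ ker f) = dim S̄ − t` and `f(S̄) = 𝔽₂^t`: the generators of `R̄` (and `dim S̄ − dim R̄ − t`
further ones) are «left alone», the remaining `t` are the ones «arranged in the same row» as generators of the other
code. (Construction: `S̄ → S̄/R̄ ≅ 𝔽₂^{t′} ↠ 𝔽₂^t` precomposed with a left inverse of `S̄ ↪ Ē`.)
[cite: YuEtAl2013, §II (chunk p0004 L96-103, Table III); Gottesman1996Pasting, (chunk p0003 L55-60: «adding on identity generators»)] -/
theorem exists_label_of_le (R S : Submodule (ZMod 2) (SympVec n)) (hRS : R ≤ S) {t : ℕ}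
    (ht : finrank (ZMod 2) R + t ≤ finrank (ZMod 2) S) :
    ∃ f : SympVec n →ₗ[ZMod 2] (Fin t → ZMod 2),
      R ≤ LinearMap.ker f ∧ finrank (ZMod 2) ↥(S ⊓ LinearMap.ker f) + t = finrank (ZMod 2) S ∧ S.map f = ⊤ := by
  classical
  set RS : Submodule (ZMod 2) S := Submodule.comap S.subtype R with hRSdef
  set t' := finrank (ZMod 2) (S ⧸ RS) with ht'
  have hRS_rank : finrank (ZMod 2) RS = finrank (ZMod 2) R := by
    rw [← Submodule.finrank_map_subtype_eq S RS, hRSdef, Submodule.map_comap_subtype, inf_eq_right.2 hRS]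
  have hq : t' + finrank (ZMod 2) R = finrank (ZMod 2) S := by
    rw [← hRS_rank, ht', Submodule.finrank_quotient_add_finrank]
  have htt' : t ≤ t' := by omega
  -- `S/R ≅ 𝔽₂^{t'}`, projection to the first `t` coordinates, a left inverse of the inclusion
  have hcond : finrank (ZMod 2) (S ⧸ RS) = finrank (ZMod 2) (Fin t' → ZMod 2) := by
    rw [Module.finrank_fin_fun]
  let e : (S ⧸ RS) ≃ₗ[ZMod 2] (Fin t' → ZMod 2) := LinearEquiv.ofFinrankEq _ _ hcond
  let pr : (Fin t' → ZMod 2) →ₗ[ZMod 2] (Fin t → ZMod 2) := LinearMap.funLeft (ZMod 2) (ZMod 2) (Fin.castLE htt')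
  obtain ⟨π, hπ⟩ := LinearMap.exists_leftInverse_of_injective S.subtype (Submodule.ker_subtype S)
  have hπx : ∀ x : S, π (x : SympVec n) = x := fun x => by
    have := LinearMap.congr_fun hπ x
    simpa using this
  obtain ⟨fS, hfS⟩ : ∃ fS : S →ₗ[ZMod 2] (Fin t → ZMod 2), fS = pr ∘ₗ e.toLinearMap ∘ₗ RS.mkQ := ⟨_, rfl⟩
  have hfS_apply : ∀ x : S, fS x = pr (e (RS.mkQ x)) := fun x => by rw [hfS]; rfl
  have hsurjS : ∀ y, ∃ x : S, fS x = y := fun y => by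
    obtain ⟨y', hy'⟩ := LinearMap.funLeft_surjective_of_injective (ZMod 2) (ZMod 2) (Fin.castLE htt')
      (Fin.castLE_injective htt') y
    obtain ⟨x, hx⟩ := RS.mkQ_surjective (e.symm y')
    exact ⟨x, by rw [hfS_apply, hx, LinearEquiv.apply_symm_apply]; exact hy'⟩
  refine ⟨fS ∘ₗ π, fun r hr => ?_, ?_, ?_⟩
  · -- `R ≤ ker f`
    rw [LinearMap.mem_ker, LinearMap.comp_apply]
    have hπr : π r = ⟨r, hRS hr⟩ := hπx ⟨r, hRS hr⟩
    rw [hπr, hfS_apply]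
    have hmk : RS.mkQ ⟨r, hRS hr⟩ = 0 := by
      rw [Submodule.mkQ_apply, Submodule.Quotient.mk_eq_zero, hRSdef, Submodule.mem_comap]
      exact hr
    rw [hmk, map_zero, map_zero]
  · -- `dim (S ∩ ker f) = dim S − t`: rank–nullity for the surjection `f|_S = fS`
    have hsurj : LinearMap.range fS = ⊤ :=
      eq_top_iff.2 fun y _ => by obtain ⟨x, hx⟩ := hsurjS y; exact ⟨x, hx⟩
    have hrn := LinearMap.finrank_range_add_finrank_ker fS
    rw [hsurj, finrank_top, Module.finrank_fin_fun] at hrn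
    have hinf : S ⊓ LinearMap.ker (fS ∘ₗ π) = Submodule.map S.subtype (LinearMap.ker fS) := by
      ext v
      rw [Submodule.mem_inf, Submodule.mem_map, LinearMap.mem_ker, LinearMap.comp_apply]
      constructor
      · rintro ⟨hvS, hvk⟩
        have hπv : π v = ⟨v, hvS⟩ := hπx ⟨v, hvS⟩
        rw [hπv] at hvk
        exact ⟨⟨v, hvS⟩, LinearMap.mem_ker.2 hvk, rfl⟩
      · rintro ⟨x, hx, rfl⟩
        refine ⟨x.2, ?_⟩
        rw [Submodule.subtype_apply, hπx]
        exact LinearMap.mem_ker.1 hx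
    rw [hinf, Submodule.finrank_map_subtype_eq]
    omega
  · -- `f(S) = 𝔽₂^t`
    refine eq_top_iff.2 fun y _ => ?_
    obtain ⟨x, hx⟩ := hsurjS y
    exact ⟨(x : SympVec n), x.2, by rw [LinearMap.comp_apply, hπx]; exact hx⟩

/-! ### 4. The pasting step `[n₂, s₂] ▷ [n₁, s₁]` -/

/-- Two vectors with different second components at qubit `0` are linearly independent: `dim ⟨X(n), (XZ)(n)⟩ = 2`
for `n ≥ 1`. [cite: YuEtAl2013, §II (chunk p0004 L29-36: X(2^m), Z(2^m) are generators)] -/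
theorem finrank_span_xz (hn : 1 ≤ n) :
    finrank (ZMod 2) (Submodule.span (ZMod 2) ({allOmega n, allOnes n} : Set (SympVec n))) = 2 := by
  have hne : allOmega n ≠ allOnes n := fun h => by
    have := congrFun (congrArg Prod.snd h) ⟨0, hn⟩
    simp at this
  have hli : LinearIndependent (ZMod 2) ![allOmega n, allOnes n] := by
    rw [LinearIndependent.pair_iff]
    intro s t hst
    have h2 := congrFun (congrArg Prod.snd hst) ⟨0, hn⟩
    have h1 := congrFun (congrArg Prod.fst hst) ⟨0, hn⟩
    simp only [Prod.snd_add, Prod.smul_snd, Pi.add_apply, Pi.smul_apply, allOmega_snd, allOnes_snd, smul_eq_mul,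
      mul_zero, zero_add, mul_one, Prod.snd_zero, Pi.zero_apply, Prod.fst_add, Prod.smul_fst, allOmega_fst,
      allOnes_fst, Prod.fst_zero] at h1 h2
    rw [h2, add_zero] at h1
    exact ⟨h1, h2⟩
  have hset : ({allOmega n, allOnes n} : Set (SympVec n)) = Set.range ![allOmega n, allOnes n] :=
    (Matrix.range_cons_cons_empty (allOmega n) (allOnes n) ![]).symm
  rw [hset, finrank_span_eq_card hli, Fintype.card_fin]

/-- **Stabilizer pasting `[n₂,s₂] ▷ [n₁,s₁]` (proved).** Let `S̄ ≤ Ē_{n₂}` be a pure `[[n₂, k₂, 3]]` code containing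
`X(n₂)` and `(XZ)(n₂)` (`s₂ = n₂ − k₂` generators, `n₂ ≥ 1`) and let a pure `[[n₁, k₁, 3]]` code exist
(`s₁ = n₁ − k₁` generators). Then a pure `[[n₂ + n₁, n₂ + n₁ − max{s₂, s₁ + 2}, 3]]` code exists: Gottesman's pasting
with `R̄₁ ⊇ ⟨X(n₂), Z(n₂)⟩` of distance `2` (plus the surplus `S`-generators when `s₂ − 2 > s₁`), `R̄₂` = the surplus
`T`-generators (distance `≥ 1`) when `s₁ > s₂ − 2`, and `t = min{s₂ − 2, s₁}` paired rows; distance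
`min{3, 3, 2 + 1} = 3` and `k = l₁ + k₂ = n₂ + n₁ − max{s₂, s₁ + 2}`.
[cite: YuEtAl2013, §II (chunk p0004 L96-103: «defines a non-degenerate stabilizer code [n₂+n₁, s] with s = max{s₂, s₁+2}»); Gottesman1997, §3.5 (chunk p0022 L59-92)] -/
theorem XZPureCodeExists.paste_of_mem {n₂ n₁ k₂ k₁ : ℕ} {S : Submodule (ZMod 2) (SympVec n₂)}
    (hS : IsAdditiveCode S k₂ 3) (hp : IsPure S 3) (hX : allOmega n₂ ∈ S) (hY : allOnes n₂ ∈ S) (hn₂ : 1 ≤ n₂)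
    (h₁ : PureAdditiveCodeExists n₁ k₁ 3) :
    PureAdditiveCodeExists (n₂ + n₁) (n₂ + n₁ - max (n₂ - k₂) (n₁ - k₁ + 2)) 3 := by
  classical
  obtain ⟨S₁, h₁c, h₁p⟩ := h₁
  have hk₂ : k₂ ≤ n₂ := by have := hS.2.1; omega
  have hk₁ : k₁ ≤ n₁ := by have := h₁c.2.1; omega
  set s₂ := n₂ - k₂ with hs₂
  set s₁ := n₁ - k₁ with hs₁
  have hdimS : finrank (ZMod 2) S = s₂ := by have := hS.2.1; omega
  have hdimS₁ : finrank (ZMod 2) S₁ = s₁ := by have := h₁c.2.1; omega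
  -- the distance-two part and its dimension
  set R := Submodule.span (ZMod 2) ({allOmega n₂, allOnes n₂} : Set (SympVec n₂)) with hR
  have hRle : R ≤ S := Submodule.span_le.2 (by
    intro x hx
    simp only [Set.mem_insert_iff, Set.mem_singleton_iff] at hx
    rcases hx with rfl | rfl
    · exact hX
    · exact hY)
  have hRdim : finrank (ZMod 2) R = 2 := finrank_span_xz hn₂
  have hs₂2 : 2 ≤ s₂ := by
    have h := Submodule.finrank_mono hRle
    rw [hRdim, hdimS] at h
    exact h
  -- number of paired rows
  set t := min (s₂ - 2) s₁ with ht
  obtain ⟨f, hRf, hfdim, hfS⟩ := exists_label_of_le R S hRle (t := t) (by rw [hRdim, hdimS]; omega)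
  obtain ⟨g, hg⟩ := exists_label_map_eq_top S₁ (s := t) (by rw [hdimS₁]; omega)
  have hfg : S.map f = S₁.map g := by rw [hfS, hg]
  have hl₁ : finrank (ZMod 2) ↥(S ⊓ LinearMap.ker f) + (n₂ - (s₂ - t)) = n₂ := by
    rw [hdimS] at hfdim; omega
  have hc₁ : HasMinDist (S ⊓ LinearMap.ker f) 2 :=
    hasMinDist_two_of_xz_mem ⟨hX, hRf (Submodule.subset_span (by simp))⟩
      ⟨hY, hRf (Submodule.subset_span (by simp))⟩
  have hc₂ : HasMinDist (S₁ ⊓ LinearMap.ker g) 1 := fun w _ hw =>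
    Nat.one_le_iff_ne_zero.2 fun h0 => hw ((sympWeight_eq_zero_iff w).1 h0 ▸ Submodule.zero_mem _)
  have hpaste := pureAdditiveCodeExists_pasting hS hp h₁c h₁p hfg hl₁ hc₁ hc₂ (by norm_num) (by norm_num)
  have hk : n₂ - (s₂ - t) + k₁ = n₂ + n₁ - max (n₂ - k₂) (n₁ - k₁ + 2) := by
    rw [← hs₂, ← hs₁]; omega
  rw [hk] at hpaste
  simpa using hpaste

/-- **Stabilizer pasting, existence form**: `[n₂, s₂] ▷ [n₁, s₁]` from `XZPureCodeExists n₂ (n₂ − s₂)` and a pure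
`[[n₁, n₁ − s₁, 3]]`. [cite: YuEtAl2013, §II (chunk p0004 L96-103)] -/
theorem XZPureCodeExists.paste {n₂ n₁ k₂ k₁ : ℕ} (h₂ : XZPureCodeExists n₂ k₂) (hn₂ : 1 ≤ n₂)
    (h₁ : PureAdditiveCodeExists n₁ k₁ 3) :
    PureAdditiveCodeExists (n₂ + n₁) (n₂ + n₁ - max (n₂ - k₂) (n₁ - k₁ + 2)) 3 := by
  obtain ⟨S, hS, hp, hX, hY⟩ := h₂
  exact XZPureCodeExists.paste_of_mem hS hp hX hY hn₂ h₁

/-! ### 5. Instance: `[37] = [2⁵] ▷ [5]` -/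

/-- **The pure optimal `[[37,30,3]]` code** `[37] = [2⁵] ▷ [5]` («a previously unknown pure optimal code»): the
`2⁵`-qubit Gottesman code (`7` generators) pasted with the five-qubit code (`4` generators),
`s = max{7, 4 + 2} = 7`. [cite: YuEtAl2013, §III Lemma 1 (chunk p0005 L12-20)] -/
theorem pureAdditiveCodeExists_37_30_3 : PureAdditiveCodeExists 37 30 3 := by
  have h := (XZPureCodeExists.gottesman (m := 5) (by norm_num)).paste (by norm_num) pureAdditiveCodeExists_5_1_3
  simpa using h

end Literature.InformationTheory.QuantumCodes
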